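import Literature.NumberTheory.Automorphic.HidaEngineModules
import Literature.NumberTheory.Automorphic.HidaTowerLemmaD
import Literature.NumberTheory.Automorphic.ArithmeticQuotientCohomologyProd
import Literature.Algebra.Homology.GroupCohomologySemilinearBijective
import HarnessLib

/-!
# Continuity of the point on the level modules (Lemma D with `O`-coefficients)

Topic `NumberTheory/Automorphic`; namespaces `Literature.Algebra.Homology` (one generic lemma on the
semilinear functoriality of group cohomology), `Literature.NumberTheory.Automorphic.PolyAction`
(generic functoriality of polynomial actions from `ℤ`-coefficients) and
`Literature.NumberTheory.Automorphic.BigHeckeGLn.TameLevel`; definitions with bodies (the coefficient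
maps `engCast`, `engCoeffMap`) and theorems; no named fact, no `sorry`.

The hypothesis `hD` of the levelwise support argument
(`Literature.Algebra.Module.map_eq_zero_or_map_eq_zero_of_levelwise`) for the level modules
`E_n(j) = H^j(X_{U(lv n)}, O/p^n)^{ord}` of `HidaEngineModules` and the character
`χ = symChar σ (symValues x)` of `HidaEngineSymbols`: **for every `ε > 0` there is `n₀` such that for
all `n ≥ n₀`, every `z ∈ O[Syms]` killing `E_n(1)` and `E_n(2)` has `‖χ(z)‖ < ε`**
(`exists_forall_norm_symChar_lt`), GIVEN the Borel–Serre inputs `hX`, `hcd`, `hr₀` of Lemma D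
(`HidaTowerLemmaD.exists_depth_forall_norm_lt_of_laKills`, which is the case `O = ℤ`).

The reduction to `O = ℤ` is the ADDITIVITY of cohomology in the coefficients: for a family
`b : Fin r → O` which is a `ℤ/p^n`-basis of `O/p^n` for every `n` (hypothesis `hb`; e.g. a
`ℤ_p`-basis of a finite free `ℤ_p`-algebra `O`), write `z ≡ ∑_δ b_δ z_δ (mod p^n)` with
`z_δ ∈ ℤ[Syms]`; the coefficient maps `a ↦ a b_δ : ℤ/p^n → O/p^n` induce Hecke-equivariant
semilinear maps `H^j(X_{U}, ℤ/p^n) → H^j(X_U, O/p^n)` (`ArithmeticQuotientCohomologySemilinear`)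
which are jointly injective (`cohomologyPiEquiv` and `semimap_bijective_of_bijective`), so that
`z_δ` kills the ordinary part of the Hida-tower factor `H^j(X_{U(lv n)}, ℤ/p^n)` for every `δ`
(`forall_smul_eq_zero_of_forall_engSmul_eq_zero`); Lemma D bounds `‖x̃(z_δ)‖`, and
`χ(z) = ∑_δ σ(b_δ) x̃(z_δ) + p^n χ(w)` with `‖σ(b_δ)‖, ‖χ(w)‖ ≤ 1` (ultrametric inequality,
integrality of continuous points `OrdinaryHeckeAlgebraGLn.norm_apply_le_one`).
[cite: Hida1994AIF, §3, proof of Thm 3.2] [cite: KhareThorne2017, §6.5, Lemma 6.17]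

## References

* H. Hida, Ann. Inst. Fourier 44 (1994), §3. [Hida1994AIF]
* C. Khare, J. A. Thorne, Amer. J. Math. 139 (2017), §6.5. [KhareThorne2017]
* K. S. Brown, *Cohomology of Groups*, GTM 87 (1982), III.1, V.5. [Brown1982CohomologyGroups]
-/

noncomputable section

open CategoryTheory groupCohomology MvPolynomial IsDedekindDomain
open scoped NumberField

/-! ### Generic: scalar endomorphisms in cohomology; semilinear maps and `⋂ₘ range Uᵐ` -/

namespace Literature.Algebra.Homology

universe u

variable {k : Type u} [CommRing k] {G : Type u} [Group G]

/-- **`Hⁿ(c · id) = c · id`**: the map induced in cohomology by the scalar endomorphism `c` of the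
coefficients is multiplication by `c`. [cite: Brown1982CohomologyGroups, III.1 Example 3] -/
theorem semimap_eq_smul_of_forall (B : Rep k G) (c : k) (s : B.V →ₛₗ[RingHom.id k] B.V)
    (hs : ∀ (g : G) (a : B.V), s (B.ρ g a) = B.ρ g (s a)) (h : ∀ a, s a = c • a)
    (n : ℕ) (x : groupCohomology B n) :
    semimap s hs n x = c • x := by
  induction x using groupCohomology_induction_on with
  | h z =>
    rw [semimap_π, ← map_smul]
    congr 1
    refine iCocycles_injective B n ?_
    rw [iCocycles_cocyclesSemimap, map_smul]
    funext g
    exact h _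

end Literature.Algebra.Homology

namespace Literature.NumberTheory.Automorphic

/-- **A semilinear map intertwining `U` and `U'` maps `⋂ₘ range Uᵐ` into `⋂ₘ range U'ᵐ`.** [folklore] -/
theorem mem_iInf_range_pow_of_semilinear {k k' : Type*} [Semiring k] [Semiring k'] {σ : k →+* k'}
    {V W : Type*} [AddCommMonoid V] [AddCommMonoid W] [Module k V] [Module k' W] (f : V →ₛₗ[σ] W)
    {U : Module.End k V} {U' : Module.End k' W} (h : ∀ v, f (U v) = U' (f v)) {x : V}
    (hx : x ∈ ⨅ m : ℕ, LinearMap.range (U ^ m)) : f x ∈ ⨅ m : ℕ, LinearMap.range (U' ^ m) := by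
  rw [Submodule.mem_iInf] at hx ⊢
  intro m
  obtain ⟨y, hy⟩ := hx m
  refine ⟨f y, ?_⟩
  rw [← hy]
  clear hy
  induction m generalizing y with
  | zero => rfl
  | succ m ih =>
    rw [pow_succ, pow_succ, Module.End.mul_apply, Module.End.mul_apply, ← h]
    exact ih (U y)

/-- **An additive map intertwining two finite commuting families intertwines their products**
(`Finset.noncommProd`). [folklore] -/
theorem map_noncommProd_apply_eq {ι' M M' : Type*} [AddCommMonoid M] [AddCommMonoid M']
    [Module ℤ M] {S' : Type*} [Semiring S'] [Module S' M'] (Φ : M →+ M') (s : Finset ι')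
    (T : ι' → Module.End ℤ M) (T' : ι' → Module.End S' M')
    (hT : (s : Set ι').Pairwise fun a b => Commute (T a) (T b))
    (hT' : (s : Set ι').Pairwise fun a b => Commute (T' a) (T' b))
    (h : ∀ i ∈ s, ∀ m, Φ (T i m) = T' i (Φ m)) (m : M) :
    Φ (s.noncommProd T hT m) = s.noncommProd T' hT' (Φ m) := by
  classical
  induction s using Finset.induction_on generalizing m with
  | empty => rfl
  | insert a s ha ih =>
    rw [Finset.noncommProd_insert_of_notMem _ _ _ _ ha, Finset.noncommProd_insert_of_notMem _ _ _ _ ha,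
      Module.End.mul_apply, Module.End.mul_apply, h a (Finset.mem_insert_self a s),
      ih (hT.mono fun _ h => Finset.mem_insert_of_mem h) (hT'.mono fun _ h => Finset.mem_insert_of_mem h)
        (fun i hi => h i (Finset.mem_insert_of_mem hi))]

namespace PolyAction

/-- **Functoriality of polynomial actions from `ℤ`-coefficients**: for a ring homomorphism
`ρ : ℤ[X_σ] → End_ℤ M`, a commuting family `t'` over `φ' : O → S'` and an additive `Φ : M → M'` with
`Φ (ρ(X_a) m) = t' a (Φ m)`, one has `Φ (ρ(z) m) = polyHom φ' t' (z ⊗ 1) (Φ m)` for every `z ∈ ℤ[X_σ]`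
(`z ⊗ 1 = map (ℤ → O) z`). [folklore] -/
theorem map_intPoly_apply {σ M : Type} [AddCommGroup M] [Module ℤ M] (ρ : MvPolynomial σ ℤ →+* Module.End ℤ M)
    {O S' M' : Type} [CommRing O] [CommRing S'] {φ' : O →+* S'} [AddCommGroup M'] [Module S' M']
    {t' : σ → Module.End S' M'} (ht' : ∀ a b, Commute (t' a) (t' b)) (Φ : M →+ M')
    (hΦt : ∀ a m, Φ (ρ (X a) m) = t' a (Φ m)) (z : MvPolynomial σ ℤ) (m : M) :
    Φ (ρ z m) = polyHom φ' t' ht' (MvPolynomial.map (Int.castRingHom O) z) (Φ m) := by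
  induction z using MvPolynomial.induction_on generalizing m with
  | C a =>
    rw [MvPolynomial.map_C, polyHom_C_apply, eq_intCast (Int.castRingHom O) a, map_intCast φ',
      Int.cast_smul_eq_zsmul, eq_intCast MvPolynomial.C a, map_intCast ρ, Module.End.intCast_apply, map_zsmul]
  | add p q hp hq => rw [map_add, map_add, map_add, LinearMap.add_apply, LinearMap.add_apply, map_add, hp, hq]
  | mul_X q a hq =>
    rw [map_mul ρ, Module.End.mul_apply, hq, hΦt, ← Module.End.mul_apply,
      map_mul (MvPolynomial.map (Int.castRingHom O)), map_X, map_mul (polyHom φ' t' ht'), polyHom_X]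

end PolyAction

namespace BigHeckeGLn

namespace TameLevel

open PolyAction Literature.Algebra.Homology

/-! ### The coefficient maps `ℤ/p^n → O/p^n` and the induced semilinear maps in cohomology -/

/-- **`ℤ/p^n → O/p^n`**, the canonical ring homomorphism. [folklore] -/
def engCast (p : ℕ) (O : Type) [CommRing O] (n : ℕ) : modPow ℤ ((p : ℕ) : ℤ) n →+* engCoeff p O n :=
  Ideal.Quotient.lift _ ((Ideal.Quotient.mk _).comp (Int.castRingHom O)) fun a ha => by
    obtain ⟨c, rfl⟩ := Ideal.mem_span_singleton'.1 ha
    rw [RingHom.comp_apply, map_mul, map_pow, map_natCast, Ideal.Quotient.eq_zero_iff_mem]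
    exact Ideal.mul_mem_left _ _ (Ideal.mem_span_singleton_self _)

/-- `engCast` on the class of an integer. [folklore] -/
@[simp]
theorem engCast_mk (p : ℕ) (O : Type) [CommRing O] (n : ℕ) (a : ℤ) :
    engCast p O n (Ideal.Quotient.mk _ a) = Ideal.Quotient.mk _ (a : O) :=
  rfl

/-- **The coefficient map `a ↦ a · ō : ℤ/p^n → O/p^n`** of an element `o ∈ O`, semilinear over
`ℤ → O/p^n`. [folklore] -/
def engCoeffMap (p : ℕ) {O : Type} [CommRing O] (n : ℕ) (o : O) :
    modPow ℤ ((p : ℕ) : ℤ) n →ₛₗ[Int.castRingHom (engCoeff p O n)] engCoeff p O n where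
  toFun a := engCast p O n a * Ideal.Quotient.mk _ o
  map_add' a a' := by rw [map_add, add_mul]
  map_smul' m a := by
    have hma : m • a = ((m : ℤ) : modPow ℤ ((p : ℕ) : ℤ) n) * a := by
      rw [← zsmul_eq_mul]
      try exact int_smul_eq_zsmul _ m a
    rw [hma, map_mul, map_intCast, smul_eq_mul, eq_intCast, mul_assoc]

/-- Unfolding `engCoeffMap`. [folklore] -/
@[simp]
theorem engCoeffMap_apply (p : ℕ) {O : Type} [CommRing O] (n : ℕ) (o : O) (a : modPow ℤ ((p : ℕ) : ℤ) n) :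
    engCoeffMap p n o a = engCast p O n a * Ideal.Quotient.mk _ o :=
  rfl

variable {K : Type} [Field K] [NumberField K] {p : ℕ} [Fact p.Prime] (𝒰 : TameLevel 2 K p)
  (O : Type) [CommRing O] (c₀ : ℕ) (lv : ℕ → ℕ)

/-- **`Hʲ(a ↦ a ō) : H^j(X_{U(lv n)}, ℤ/p^n) → H^j(X_{U(lv n)}, O/p^n)`**, the semilinear map of
the Hida-tower factor into the cohomology carrying the level module `E_n(j)`.
[cite: Brown1982CohomologyGroups, V.5] -/
def engCohMap (n j : ℕ) (o : O) :
    𝒰.hidaCohomology ℤ (j, lv n, n) →ₛₗ[Int.castRingHom (engCoeff p O n)] 𝒰.engCohomology O lv n j :=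
  ArithmeticQuotient.cohomologySemimap (globalEmbedding 2 K) (𝒰.level (lv n) (max (lv n) 1))
    (engCoeffMap p n o) j

variable {O c₀ lv}

/-- **`Hʲ(a ↦ a ō)` is Hecke-equivariant**: it carries the tower operator `[U(lv n) g U(lv n)]` to
`engHecke g`. [folklore] -/
theorem engCohMap_hidaFamily (n j : ℕ) (o : O) (g : FiniteAdelicGL 2 K) (y : 𝒰.hidaCohomology ℤ (j, lv n, n)) :
    𝒰.engCohMap O lv n j o (HidaEndFactor.toEnd 𝒰 ℤ (𝒰.hidaFamily ℤ g (j, lv n, n)) y) =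
      𝒰.engHecke O lv n j g (𝒰.engCohMap O lv n j o y) :=
  ArithmeticQuotient.cohomologySemimap_heckeEnd (globalEmbedding 2 K) (𝒰.level (lv n) (max (lv n) 1))
    (engCoeffMap p n o) g j y

/-- `Hʲ(a ↦ a ō)` maps the ordinary part of the tower factor into `engOrd`. [folklore] -/
theorem engCohMap_mem_engOrd (h𝒰 : 𝒰.IsMaximalAbove) (n j : ℕ) (o : O) {y : 𝒰.hidaCohomology ℤ (j, lv n, n)}
    (hy : y ∈ 𝒰.ordinaryPart ℤ (j, lv n, n)) : 𝒰.engCohMap O lv n j o y ∈ 𝒰.engOrd O lv n j := by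
  rw [ordinaryPart_eq_iInf_range 𝒰 h𝒰 ℤ (j, lv n, n)] at hy
  simp only [Submodule.mem_iInf] at hy
  simp only [engOrd, Submodule.mem_iInf]
  intro v
  letI : Unique (Fin (2 - 1)) := inferInstanceAs (Unique (Fin 1))
  have hy' : y ∈ ⨅ m : ℕ, LinearMap.range (HidaEndFactor.toEnd 𝒰 ℤ
      (𝒰.hidaFamily ℤ (heckeElement 2 K v.1 1) (j, lv n, n)) ^ m) :=
    (Submodule.mem_iInf _).2 (hy v default)
  exact (Submodule.mem_iInf _).1
    (mem_iInf_range_pow_of_semilinear (𝒰.engCohMap O lv n j o) (fun w => 𝒰.engCohMap_hidaFamily n j o _ w) hy')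

/-- `Hʲ(a ↦ a ō) = ō · Hʲ(a ↦ a)`. [folklore] -/
theorem engCohMap_eq_smul (n j : ℕ) (o : O) (y : 𝒰.hidaCohomology ℤ (j, lv n, n)) :
    𝒰.engCohMap O lv n j o y = (Ideal.Quotient.mk _ o : engCoeff p O n) • 𝒰.engCohMap O lv n j 1 y := by
  have h1 := ArithmeticQuotient.cohomologySemimap_cohomologySemimap (globalEmbedding 2 K)
    (𝒰.level (lv n) (max (lv n) 1)) (engCoeffMap p n (1 : O))
    ((Ideal.Quotient.mk _ o : engCoeff p O n) • (LinearMap.id : engCoeff p O n →ₗ[engCoeff p O n] engCoeff p O n))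
    (engCoeffMap p n o) (fun a => by
      rw [engCoeffMap_apply, LinearMap.smul_apply, LinearMap.id_apply, engCoeffMap_apply, map_one, mul_one,
        smul_eq_mul, mul_comm]) j y
  exact h1.symm.trans (semimap_eq_smul_of_forall _ _ _
    (ArithmeticQuotient.coeffSemimap_coeffRepresentation (globalEmbedding 2 K) (𝒰.level (lv n) (max (lv n) 1)) _)
    (fun f => rfl) j _)

/-! ### The action of `ℤ[Syms]` on the tower factor corresponds to that of `O[Syms]` on `E_n(j)` -/

variable [Fact 𝒰.IsMaximalAbove]

/-- The tower-side action of `ℤ[Syms]` at the index `(j, lv n, n)`: `w ↦ (hidaPolyHom (symbolMap w))_{(j, lv n, n)}`.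
[folklore] -/
abbrev towerSymHom (n j : ℕ) : MvPolynomial (𝒰.Syms c₀) ℤ →+* Module.End ℤ (𝒰.hidaCohomology ℤ (j, lv n, n)) :=
  (𝒰.hidaPolyHomAt (j, lv n, n)).comp (𝒰.symbolMapS c₀)

omit [Fact 𝒰.IsMaximalAbove] in
/-- The tower operator of `torusElement d` at level `U(lv n)` is the product of the diamond operators.
[folklore] -/
theorem engHecke_torusElement_eq_noncommProd (h𝒰 : 𝒰.IsMaximalAbove) (n j : ℕ) (d : TorusDatum K p c₀) :
    𝒰.engHecke O lv n j d.torusElement =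
      (Finset.univ : Finset (PlacesAbove K p)).noncommProd
        (fun v => 𝒰.engHecke O lv n j (diamondElement 2 K v.1 (d.units v)))
        (fun v _ w _ _ => (𝒰.levelDiamond_commute h𝒰 v.2 (lv n) (max (lv n) 1) (engCoeff p O n) (engCoeff p O n) j
          w.2 (d.units v) (d.units w))) := by
  rw [𝒰.engHecke_torusElement h𝒰, levelTorus, MonoidHom.noncommPiCoprod_apply]
  exact Finset.noncommProd_congr rfl (fun v _ => by rw [levelDiamond_apply]) _

/-- `hidaPolyHomAt (torusMonomial d)` is the product of the diamond operators of the tower. [folklore] -/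
theorem towerSymHom_X_inr (n j : ℕ) (d : TorusDatum K p c₀) :
    𝒰.towerSymHom n j (X (Sum.inr d)) =
      (Finset.univ : Finset (PlacesAbove K p)).noncommProd
        (fun v => HidaEndFactor.toEnd 𝒰 ℤ (𝒰.hidaFamily ℤ (diamondElement 2 K v.1 (d.units v)) (j, lv n, n)))
        (fun v _ w _ _ => by
          have h := Commute.all
            (X ⟨diamondElement 2 K v.1 (d.units v), 𝒰.diamondElement_mem_hidaElements v.2 _⟩ : MvPolynomial 𝒰.hidaElements ℤ)
            (X ⟨diamondElement 2 K w.1 (d.units w), 𝒰.diamondElement_mem_hidaElements w.2 _⟩)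
          have h' := h.map (𝒰.hidaPolyHomAt (j, lv n, n))
          rwa [hidaPolyHomAt_X, hidaPolyHomAt_X] at h') := by
  rw [RingHom.comp_apply, symbolMapS_X_inr, torusMonomial, ← Finset.noncommProd_eq_prod, Finset.map_noncommProd]
  exact Finset.noncommProd_congr rfl (fun v _ => by rw [hidaPolyHomAt_X]) _

/-- **`Hʲ(a ↦ a) ∘ (ℤ[Syms]-action on the tower) = (O[Syms]-action on H^j(X_{U(lv n)}, O/p^n)) ∘ Hʲ(a ↦ a)`.**
[cite: KhareThorne2017, §6.5] -/
theorem engCohMap_towerSymHom (n j : ℕ) (w : MvPolynomial (𝒰.Syms c₀) ℤ) (y : 𝒰.hidaCohomology ℤ (j, lv n, n)) :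
    𝒰.engCohMap O lv n j 1 (𝒰.towerSymHom n j w y) =
      𝒰.engPolyHomFull (O := O) (c₀ := c₀) (lv := lv) n j (MvPolynomial.map (Int.castRingHom O) w)
        (𝒰.engCohMap O lv n j 1 y) := by
  have h𝒰 : 𝒰.IsMaximalAbove := Fact.out
  refine map_intPoly_apply (𝒰.towerSymHom n j) (𝒰.engFamily_comm n j) (𝒰.engCohMap O lv n j 1).toAddMonoidHom
    (fun a m => ?_) w y
  change 𝒰.engCohMap O lv n j 1 (𝒰.towerSymHom n j (X a) m) = 𝒰.engFamily O c₀ lv n j a (𝒰.engCohMap O lv n j 1 m)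
  rcases a with g | d
  · rw [RingHom.comp_apply, symbolMapS_X_inl, hidaPolyHomAt_X, engFamily_inl]
    exact 𝒰.engCohMap_hidaFamily n j 1 g.1 m
  · rw [towerSymHom_X_inr, engFamily_inr, 𝒰.engHecke_torusElement_eq_noncommProd h𝒰]
    exact map_noncommProd_apply_eq (𝒰.engCohMap O lv n j 1).toAddMonoidHom Finset.univ _ _ _ _
      (fun v _ m' => 𝒰.engCohMap_hidaFamily n j 1 _ m') m

/-! ### Joint injectivity of the coefficient maps of a basis -/

variable (O) in
/-- **Basis hypothesis**: `b : Fin r → O` reduces to a `ℤ/p^n`-basis of `O/p^n` for every `n`,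
i.e. `(a_δ) ↦ ∑_δ a_δ b̄_δ` is a bijection `(ℤ/p^n)^r → O/p^n`. [folklore] -/
def IsReductionBasis {r : ℕ} (b : Fin r → O) : Prop :=
  ∀ n : ℕ, Function.Bijective fun a : Fin r → modPow ℤ ((p : ℕ) : ℤ) n =>
    ∑ δ, engCast p O n (a δ) * Ideal.Quotient.mk _ (b δ)

omit [Fact 𝒰.IsMaximalAbove] in
/-- **The maps `Hʲ(a ↦ a b̄_δ)` of a reduction basis are jointly injective**: if
`∑_δ Hʲ(a ↦ a b̄_δ)(u_δ) = 0` then every `u_δ = 0` (additivity of `Hʲ` and bijectivity of `Hʲ` of a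
bijective coefficient map). [cite: Brown1982CohomologyGroups, V.5] -/
theorem forall_eq_zero_of_sum_engCohMap_eq_zero {r : ℕ} {b : Fin r → O} (hb : IsReductionBasis (p := p) O b)
    (n j : ℕ) (u : Fin r → 𝒰.hidaCohomology ℤ (j, lv n, n))
    (hu : ∑ δ, 𝒰.engCohMap O lv n j (b δ) (u δ) = 0) (δ : Fin r) : u δ = 0 := by
  classical
  set L := 𝒰.level (lv n) (max (lv n) 1) with hL
  set Zn : Type := modPow ℤ ((p : ℕ) : ℤ) n with hZn
  -- the class with the prescribed components
  set e := ArithmeticQuotient.cohomologyPiEquiv ℤ (globalEmbedding 2 K) L j (J := Fin r) Zn with he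
  set x := e.symm u with hx
  have hux : ∀ δ, u δ = ArithmeticQuotient.cohomologyProj ℤ (globalEmbedding 2 K) L j Zn δ x := fun δ => by
    rw [← ArithmeticQuotient.cohomologyPiEquiv_apply, hx, LinearEquiv.apply_symm_apply]
  -- the total coefficient map `(a_δ) ↦ ∑ a_δ b̄_δ`
  set tot : (Fin r → Zn) →ₛₗ[Int.castRingHom (engCoeff p O n)] engCoeff p O n :=
    { toFun := fun a => ∑ δ, engCast p O n (a δ) * Ideal.Quotient.mk _ (b δ)
      map_add' := fun a a' => by
        rw [← Finset.sum_add_distrib]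
        exact Finset.sum_congr rfl fun δ _ => by rw [Pi.add_apply, map_add, add_mul]
      map_smul' := fun m a => by
        rw [Finset.smul_sum]
        exact Finset.sum_congr rfl fun δ _ => by
          rw [Pi.smul_apply]
          exact (engCoeffMap p n (b δ)).map_smul' m (a δ) } with htot
  have htot_apply : ∀ a, tot a = ∑ δ, engCoeffMap p n (b δ) ((LinearMap.proj δ : (Fin r → Zn) →ₗ[ℤ] Zn) a) :=
    fun a => rfl
  -- `∑_δ Hʲ(a ↦ a b̄_δ) ∘ Hʲ(proj_δ) = Hʲ(tot)`
  have hsum : ∑ δ, 𝒰.engCohMap O lv n j (b δ) (u δ) =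
      ArithmeticQuotient.cohomologySemimap (globalEmbedding 2 K) L tot j x := by
    have hcomp : ∀ δ, 𝒰.engCohMap O lv n j (b δ) (u δ) =
        ArithmeticQuotient.cohomologySemimap (globalEmbedding 2 K) L
          ((engCoeffMap p n (b δ)).comp (LinearMap.proj δ : (Fin r → Zn) →ₗ[ℤ] Zn)) j x := fun δ => by
      rw [hux δ, engCohMap, ArithmeticQuotient.cohomologyProj]
      exact ArithmeticQuotient.cohomologySemimap_cohomologySemimap (globalEmbedding 2 K) L _ _ _ (fun _ => rfl) j x
    simp_rw [hcomp]
    unfold ArithmeticQuotient.cohomologySemimap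
    set R : Rep ℤ (GL (Fin 2) K) := ArithmeticQuotient.coeffRep ℤ (globalEmbedding 2 K) L (Fin r → Zn) with hR
    set R' : Rep (engCoeff p O n) (GL (Fin 2) K) :=
      ArithmeticQuotient.coeffRep (engCoeff p O n) (globalEmbedding 2 K) L (engCoeff p O n) with hR'
    set S : Fin r → (R.V →ₛₗ[Int.castRingHom (engCoeff p O n)] R'.V) := fun δ =>
      ArithmeticQuotient.coeffSemimap L ((engCoeffMap p n (b δ)).comp (LinearMap.proj δ : (Fin r → Zn) →ₗ[ℤ] Zn))
      with hS
    have hs : ∀ (δ : Fin r) (γ : GL (Fin 2) K) (a : R.V), S δ (R.ρ γ a) = R'.ρ γ (S δ a) :=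
      fun δ => ArithmeticQuotient.coeffSemimap_coeffRepresentation (globalEmbedding 2 K) L _
    have hsum' : ∀ (γ : GL (Fin 2) K) (a : R.V), (∑ δ ∈ Finset.univ, S δ) (R.ρ γ a) = R'.ρ γ ((∑ δ ∈ Finset.univ, S δ) a) := by
      intro γ a
      rw [LinearMap.sum_apply, LinearMap.sum_apply, map_sum]
      exact Finset.sum_congr rfl fun δ _ => hs δ γ a
    change ∑ δ, semimap (A := R) (B := R') (S δ) (hs δ) j x = _
    rw [← semimap_sum (A := R) (B := R') Finset.univ S hs hsum' j x]
    exact semimap_congr (A := R) (B := R') _ hsum' _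
      (ArithmeticQuotient.coeffSemimap_coeffRepresentation (globalEmbedding 2 K) L tot) (fun f => _root_.funext fun c => by
        rw [LinearMap.sum_apply, Finset.sum_apply, ArithmeticQuotient.coeffSemimap_apply, htot_apply]
        rfl) j x
  -- `Hʲ(tot)` is bijective, hence `x = 0` and every `u_δ = 0`
  have hbij : Function.Bijective (ArithmeticQuotient.cohomologySemimap (globalEmbedding 2 K) L tot j) := by
    unfold ArithmeticQuotient.cohomologySemimap
    refine semimap_bijective_of_bijective _ _ ⟨fun f f' hff' => _root_.funext fun c => ?_, fun f' => ?_⟩ j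
    · exact (hb n).1 (congr_fun hff' c)
    · refine ⟨fun c => Function.surjInv (hb n).2 (f' c), _root_.funext fun c => ?_⟩
      exact Function.surjInv_eq (hb n).2 (f' c)
  have hx0 : x = 0 := hbij.1 (by rw [← hsum, hu, map_zero])
  rw [hux δ, hx0, map_zero]
  rfl

/-! ### From `O[Syms]` killing `E_n(j)` to `ℤ[Syms]` killing the tower factor -/

/-- **Component transport.**  If `z = ∑_δ C(b_δ) · (z_δ ⊗ 1)` (with `z_δ ∈ ℤ[Syms]`, `b` a reduction
basis) kills `E_n(j)`, then every `symbolMap (z_δ)` kills the ordinary part of the tower factor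
`H^j(X_{U(lv n)}, ℤ/p^n)`. [cite: Hida1994AIF, §3] [cite: KhareThorne2017, §6.5, Lemma 6.17] -/
theorem forall_smul_eq_zero_of_forall_engSmul_eq_zero {r : ℕ} {b : Fin r → O}
    (hb : IsReductionBasis (p := p) O b) {n j : ℕ} (zc : Fin r → MvPolynomial (𝒰.Syms c₀) ℤ)
    (hz : ∀ m : 𝒰.EngMod O lv n j,
      (∑ δ, C (b δ) * MvPolynomial.map (Int.castRingHom O) (zc δ)) • m = 0)
    (δ : Fin r) (m : 𝒰.ordinaryPart ℤ (j, lv n, n)) : 𝒰.symbolMapS c₀ (zc δ) • m = 0 := by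
  have h𝒰 : 𝒰.IsMaximalAbove := Fact.out
  -- the test class `Y = Hʲ(a ↦ a)(m)` in `E_n(j)`
  have hzY := congrArg (fun m : 𝒰.EngMod O lv n j => (m : 𝒰.engCohomology O lv n j))
    (hz (EngMod.mk 𝒰 O lv (𝒰.engCohMap O lv n j 1 (m : 𝒰.hidaCohomology ℤ (j, lv n, n)))
      (𝒰.engCohMap_mem_engOrd h𝒰 n j 1 m.2)))
  simp only [coe_engSmul, EngMod.coe_mk, EngMod.coe_zero, map_sum, LinearMap.sum_apply] at hzY
  -- each summand is `Hʲ(a ↦ a b̄_δ)` of the tower-side class `symbolMap (z_δ) • m`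
  have hterm : ∀ δ', 𝒰.engPolyHomFull (O := O) (c₀ := c₀) (lv := lv) n j
      (C (b δ') * MvPolynomial.map (Int.castRingHom O) (zc δ')) (𝒰.engCohMap O lv n j 1 (m : 𝒰.hidaCohomology ℤ (j, lv n, n))) =
      𝒰.engCohMap O lv n j (b δ') (𝒰.towerSymHom n j (zc δ') (m : 𝒰.hidaCohomology ℤ (j, lv n, n))) := fun δ' => by
    rw [map_mul, Module.End.mul_apply, ← engCohMap_towerSymHom, polyHom_C_apply, 𝒰.engCohMap_eq_smul n j (b δ')]
  simp_rw [hterm] at hzY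
  have h0 := 𝒰.forall_eq_zero_of_sum_engCohMap_eq_zero hb n j _ hzY δ
  -- `towerSymHom (z_δ) m = 0` is `symbolMap (z_δ) • m = 0`
  refine Subtype.ext ?_
  rw [coe_heckePoly_smul, ZeroMemClass.coe_zero]
  exact h0

/-! ### Decomposition of `z ∈ O[Syms]` along a reduction basis modulo `p^n` -/

omit [Fact 𝒰.IsMaximalAbove] in
/-- **Every `z ∈ O[Syms]` is `≡ ∑_δ C(b_δ) (z_δ ⊗ 1) (mod p^n)`** with `z_δ ∈ ℤ[Syms]`, for a reduction
basis `b`. [folklore] -/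
theorem exists_eq_sum_C_mul_map_add {r : ℕ} {b : Fin r → O} (hb : IsReductionBasis (p := p) O b) (n : ℕ)
    (z : MvPolynomial (𝒰.Syms c₀) O) :
    ∃ (zc : Fin r → MvPolynomial (𝒰.Syms c₀) ℤ) (w : MvPolynomial (𝒰.Syms c₀) O),
      z = (∑ δ, C (b δ) * MvPolynomial.map (Int.castRingHom O) (zc δ)) + C ((p : O) ^ n) * w := by
  classical
  -- coefficientwise: `o ≡ ∑_δ a_δ b_δ (mod p^n)` with `a_δ ∈ ℤ`
  have hcoeff : ∀ o : O, ∃ (a : Fin r → ℤ) (q : O), o = (∑ δ, b δ * (a δ : O)) + (p : O) ^ n * q := by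
    intro o
    obtain ⟨a', ha'⟩ := (hb n).2 (Ideal.Quotient.mk _ o)
    have hmem : o - ∑ δ, b δ * ((Quotient.out (a' δ) : ℤ) : O) ∈ Ideal.span {((p : ℕ) : O) ^ n} := by
      rw [← Ideal.Quotient.eq, ← ha', map_sum]
      refine Finset.sum_congr rfl fun δ _ => ?_
      rw [map_mul, mul_comm]
      congr 1
      conv_lhs => rw [← Ideal.Quotient.mk_out (a' δ)]
      rfl
    obtain ⟨q, hq⟩ := Ideal.mem_span_singleton'.1 hmem
    refine ⟨fun δ => Quotient.out (a' δ), q, ?_⟩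
    linear_combination -hq
  choose a q haq using hcoeff
  refine ⟨fun δ => ∑ μ ∈ z.support, monomial μ (a (coeff μ z) δ), ∑ μ ∈ z.support, monomial μ (q (coeff μ z)), ?_⟩
  conv_lhs => rw [z.as_sum]
  simp_rw [map_sum, map_monomial, Finset.mul_sum, C_mul_monomial, eq_intCast]
  rw [Finset.sum_comm, ← Finset.sum_add_distrib]
  refine Finset.sum_congr rfl fun μ _ => ?_
  rw [← map_sum, ← map_add (monomial μ), ← haq]

/-! ### Integrality of `χ` and the final estimate -/

/-- **`‖χ(w)‖ ≤ 1` on `O[Syms]`** for `χ = symChar σ (symValues x)` with `‖σ(o)‖ ≤ 1` and `x` integral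
(`‖x(t)‖ ≤ 1`, e.g. continuous: `OrdinaryHeckeAlgebraGLn.norm_apply_le_one`). [cite: Hida1994AIF, §3] -/
theorem norm_symChar_le_one (x : OrdinaryHeckeAlgebraGLn 𝒰 →+* PadicAlgCl p) (hx1 : ∀ t, ‖x t‖ ≤ 1)
    (σ : O →+* PadicAlgCl p) (hσ : ∀ o, ‖σ o‖ ≤ 1) (w : MvPolynomial (𝒰.Syms c₀) O) :
    ‖𝒰.symChar O σ c₀ (𝒰.symValues x c₀) w‖ ≤ 1 := by
  have hval : ∀ s : 𝒰.Syms c₀, ‖𝒰.symValues x c₀ s‖ ≤ 1 := by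
    rintro (g | d)
    · exact hx1 _
    · rw [symValues_inr, norm_prod]
      exact Finset.prod_le_one (fun v _ => norm_nonneg _) fun v _ => hx1 _
  rw [symChar, coe_eval₂Hom, eval₂_eq]
  refine IsUltrametricDist.norm_sum_le_of_forall_le_of_nonneg zero_le_one fun μ _ => ?_
  rw [norm_mul]
  refine mul_le_one₀ (hσ _) (norm_nonneg _) ?_
  refine Finset.prod_induction _ (fun t => ‖t‖ ≤ 1) (fun a b ha hb => ?_) (by simp) fun s _ => ?_
  · rw [norm_mul]; exact mul_le_one₀ ha (norm_nonneg _) hb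
  · rw [norm_pow]; exact pow_le_one₀ (norm_nonneg _) (hval s)

/-- `χ (w ⊗ 1) = x (heckePolyHom (symbolMap w))` for `w ∈ ℤ[Syms]`. [folklore] -/
theorem symChar_map_intCast (x : OrdinaryHeckeAlgebraGLn 𝒰 →+* PadicAlgCl p) (σ : O →+* PadicAlgCl p)
    (w : MvPolynomial (𝒰.Syms c₀) ℤ) :
    𝒰.symChar O σ c₀ (𝒰.symValues x c₀) (MvPolynomial.map (Int.castRingHom O) w) =
      x (𝒰.heckePolyHom (𝒰.symbolMapS c₀ w)) := by
  have h : (𝒰.symChar O σ c₀ (𝒰.symValues x c₀)).comp (MvPolynomial.map (Int.castRingHom O)) =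
      (x.comp 𝒰.heckePolyHom).comp (𝒰.symbolMapS c₀) := by
    refine MvPolynomial.ringHom_ext (fun a => ?_) fun s => ?_
    · simp only [eq_intCast, map_intCast]
    · rw [RingHom.comp_apply, MvPolynomial.map_X, symChar_X, RingHom.comp_apply, RingHom.comp_apply,
        symValues_eq_apply_heckePolyHom_symbolMapS]
  exact RingHom.congr_fun h w

omit [Fact 𝒰.IsMaximalAbove] in
/-- `‖p^n‖ → 0` in `ℚ̄_p`: there is `n` with `‖(p : ℚ̄_p)‖^n < ε`. [folklore] -/
theorem exists_norm_prime_pow_lt {ε : ℝ} (hε : 0 < ε) : ∃ n : ℕ, ∀ m, n ≤ m → ‖((p : ℕ) : PadicAlgCl p) ^ m‖ < ε := by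
  have hp : ‖((p : ℕ) : PadicAlgCl p)‖ < 1 := by
    rw [← map_natCast (algebraMap ℚ_[p] (PadicAlgCl p)), PadicAlgCl.norm_extends, Padic.norm_p]
    exact inv_lt_one_of_one_lt₀ (by exact_mod_cast (Fact.out : p.Prime).one_lt)
  obtain ⟨n, hn⟩ := exists_pow_lt_of_lt_one hε hp
  refine ⟨n, fun m hm => ?_⟩
  rw [norm_pow]
  exact (pow_le_pow_of_le_one (norm_nonneg _) hp.le hm).trans_lt hn

/-- **Continuity of the point on the level modules (hypothesis `hD` of the levelwise support
argument).**  GIVEN the Borel–Serre inputs `hX`, `hcd` and a neatness threshold `hr₀`: for a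
continuous `x : 𝕋^{S,ord}(U) → ℚ̄_p`, `σ : O → ℚ̄_p` with `‖σ‖ ≤ 1`, a reduction basis `b` of `O`, and
level depths `lv n ≥ max n 1`, for every `ε > 0` there is `n₀` such that for all `n ≥ n₀` every
`z ∈ O[Syms]` killing `E_n(1)` and `E_n(2)` has `‖χ(z)‖ < ε`, `χ = symChar σ (symValues x)`.
[cite: Hida1994AIF, §3, proof of Thm 3.2] [cite: KhareThorne2017, §6.5, Lemma 6.17] -/
theorem exists_forall_norm_symChar_lt (hX : BorelSerre1973_finite_groupCohomology_congruenceSubgroup)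
    (hcd : ∀ (W : Subgroup (FiniteAdelicGL 2 K)),
      IsOpen (W : Set (FiniteAdelicGL 2 K)) → IsCompact (W : Set (FiniteAdelicGL 2 K)) →
      (∀ γ ∈ W.comap (globalEmbedding 2 K), IsOfFinOrder γ → γ = 1) →
      ∀ (A : Rep ℤ (W.comap (globalEmbedding 2 K))) (q : ℕ), 3 ≤ q → Subsingleton (groupCohomology A q))
    {r₀ : ℕ}
    (hr₀ : ∀ r : ℕ, r₀ ≤ r → ∀ (g : FiniteAdelicGL 2 K) (γ : GL (Fin 2) K), IsOfFinOrder γ →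
      g⁻¹ * globalEmbedding 2 K γ * g ∈ 𝒰.hidaLevel r → γ = 1)
    (x : OrdinaryHeckeAlgebraGLn 𝒰 →+* PadicAlgCl p) (hx : Continuous x)
    (σ : O →+* PadicAlgCl p) (hσ : ∀ o, ‖σ o‖ ≤ 1) {r : ℕ} {b : Fin r → O} (hb : IsReductionBasis (p := p) O b)
    (hlv : ∀ n, n ≤ lv n) (hlv1 : ∀ n, 1 ≤ lv n) {ε : ℝ} (hε : 0 < ε) :
    ∃ n₀ : ℕ, ∀ n, n₀ ≤ n → ∀ z : MvPolynomial (𝒰.Syms c₀) O,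
      (∀ m : 𝒰.EngMod O lv n 1, z • m = 0) → (∀ m : 𝒰.EngMod O lv n 2, z • m = 0) →
      ‖𝒰.symChar O σ c₀ (𝒰.symValues x c₀) z‖ < ε := by
  classical
  obtain ⟨c₁, -, hc₁⟩ := 𝒰.exists_depth_forall_norm_lt_of_laKills hX hcd hr₀ x hx hε
  obtain ⟨n₁, hn₁⟩ := exists_norm_prime_pow_lt (p := p) hε
  refine ⟨max c₁ n₁, fun n hn z hz₁ hz₂ => ?_⟩
  have hc₁n : c₁ ≤ n := (le_max_left _ _).trans hn
  have hn₁n : n₁ ≤ n := (le_max_right _ _).trans hn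
  obtain ⟨zc, w, hzw⟩ := 𝒰.exists_eq_sum_C_mul_map_add hb n z
  -- the `p^n`-multiple acts by zero, so the main part kills `E_n(1)` and `E_n(2)` too
  have hpn : ∀ (j : ℕ) (m : 𝒰.EngMod O lv n j), (C ((p : O) ^ n) * w) • m = 0 := fun j m => by
    rw [engSmul_def, map_mul, Module.End.mul_apply, engPolyHom, polyHom_C_apply]
    have h0 : (Ideal.Quotient.mk (Ideal.span {((p : ℕ) : O) ^ n}) ((p : O) ^ n) : engCoeff p O n) = 0 :=
      Ideal.Quotient.eq_zero_iff_mem.2 (Ideal.mem_span_singleton_self _)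
    rw [h0, zero_smul]
  have hmain : ∀ j : ℕ, (∀ m : 𝒰.EngMod O lv n j, z • m = 0) →
      ∀ m : 𝒰.EngMod O lv n j, (∑ δ, C (b δ) * MvPolynomial.map (Int.castRingHom O) (zc δ)) • m = 0 := by
    intro j hzj m
    have h := hzj m
    rwa [hzw, add_smul, hpn j m, add_zero] at h
  -- component transport and Lemma D bound each `x̃(symbolMap z_δ)`
  have hcomp : ∀ δ, ‖x (𝒰.heckePolyHom (𝒰.symbolMapS c₀ (zc δ)))‖ < ε := by
    intro δ
    have hk : ∀ j : ℕ, (∀ m : 𝒰.EngMod O lv n j, z • m = 0) → 𝒰.LaKills (lv n) (lv n) n j (𝒰.symbolMapS c₀ (zc δ)) := by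
      intro j hzj
      have h := (𝒰.forall_smul_eq_zero_iff_laPolyHom (lv n) n j (𝒰.symbolMapS c₀ (zc δ))).1
        (𝒰.forall_smul_eq_zero_of_forall_engSmul_eq_zero hb zc (hmain j hzj) δ)
      rwa [max_eq_left (hlv1 n)] at h
    exact hc₁ (lv n) n (hc₁n.trans (hlv n)) hc₁n _ (hk 1 hz₁) (hk 2 hz₂)
  -- `χ(z) = ∑_δ σ(b_δ) x̃(symbolMap z_δ) + p^n χ(w)`
  have hx1 : ∀ t, ‖x t‖ ≤ 1 := OrdinaryHeckeAlgebraGLn.norm_apply_le_one x hx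
  rw [hzw, map_add, map_sum]
  refine (IsUltrametricDist.norm_add_le_max _ _).trans_lt (max_lt ?_ ?_)
  · rcases (Finset.univ : Finset (Fin r)).eq_empty_or_nonempty with h0 | hne
    · rw [h0, Finset.sum_empty, norm_zero]; exact hε
    · obtain ⟨δ, -, hδ⟩ := IsUltrametricDist.exists_norm_finsetSum_le_of_nonempty hne
        (fun δ => 𝒰.symChar O σ c₀ (𝒰.symValues x c₀) (C (b δ) * MvPolynomial.map (Int.castRingHom O) (zc δ)))
      refine hδ.trans_lt ?_
      rw [map_mul, symChar_C, symChar_map_intCast, norm_mul]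
      exact (mul_le_of_le_one_left (norm_nonneg _) (hσ _)).trans_lt (hcomp δ)
  · rw [map_mul, symChar_C, norm_mul, map_pow, map_natCast]
    exact (mul_le_of_le_one_right (norm_nonneg _) (𝒰.norm_symChar_le_one x hx1 σ hσ w)).trans_lt (hn₁ n hn₁n)

end TameLevel

end BigHeckeGLn

end Literature.NumberTheory.Automorphic
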